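import Literature.Geometry.Kaehler.ComplexTorusTwistedProductFunctorial
import Literature.Geometry.Kaehler.ComplexTorusHolomorphicMaps
import HarnessLib

/-!
# Isomorphisms of Debarre's twisted products respecting the complementary pairs come from the factors
# (Iribar López 2024, Def. 4: "`𝒜'_{u,g−u,δ}` parametrizes triplets"; Auffarth 2016, Thm. 3.5 — the converse half)

Layer `Literature/Geometry/Kaehler`, namespace `Literature.Geometry.Kaehler.ComplexTorus`; lane `lit-hodgefound`
(Track 2 foundations library, Layer A4, row A4-77, seat `lit-hodgefound-skel-4`, FILE I of the row).  Sequel of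
`ComplexTorusTwistedProductFunctorial.lean` (FILE H: the EQUIVARIANCE half — polarised isomorphisms `α`, `β` of the
factors descend to `((Y × Z)/graph(p), θ_p) ⥲ ((Y' × Z')/graph(β|_K p α|_K⁻¹), θ_{p'})`) and of
`ComplexTorusAntisymplecticGraphQuotient.lean` (A4-76 FILE A: `graphSubgroup`, the projection
`π : Y × Z → (Y × Z)/graph(p)`, injective on the factors).  Consumed BY NAME, in addition: p25's
`IsPolarizedIso.exists_matrix` / `exists_isPolarizedIso_of_matrix` (`SiegelLevelModuli`), `exists_matrix_of_lattice_le` and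
`mapMatrix_injective` (`ComplexTorusHolomorphicMaps`, Lange–Birkenhake §1.1.2: the rational representation), the
quotient-torus kit `quotientByPeriod` / `quotientMatrix` / `liftLatticeMatrix` (`ComplexTorusQuotientFiniteSubgroup`).

## Sources, verbatim

A. Iribar López, *Noether–Lefschetz cycles on the moduli space of abelian varieties*, Forum Math. Pi (2026),
held text `paper:arxiv-2411.09910`, §2.2 Lemma 10 (p. 7 L124–L137) and Def. 4 (p. 8 L1–L17):

> "Moreover, the isomorphism type of `((Y × Z)/graph(p), θ_p)` does not depend on `p`, and all principally
> polarized abelian varieties having `Y` and `Z` as complementary subvarieties arise this way."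
> "The symplectic group of `K(δ)` acts on `𝒜^{lev}_{u,δ} × 𝒜^{lev}_{g−u,δ̃}` and `𝒫_{g,δ}` is invariant under this
> action. Let `𝒜'_{u,g−u,δ}` be the quotient by this action. It parametrizes triplets `(X, Y, Z, θ)` where
> `(X, θ)` is a principally polarized abelian variety of dimension `g`, and `Y`, `Z` are complementary
> subvarieties of a principally polarized abelian variety `X`, of dimensions `u` and `g − u`, and the type of
> the induced polarizations `θ|_Y`, `θ|_Z` is `δ` and `δ̃`, respectively."

R. Auffarth, *On a numerical characterization of non-simple principally polarized abelian varieties*,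
Math. Z. 282 (2016), held text `paper:arxiv-1507.08618`, §3 Thm. 3.5 (p. 9 L58–L62) and its proof (p. 10 L1):

> "**Theorem 3.5.** If `u < n/2`, the morphism `Φ_{u,n−u}(D)` induces an isomorphism
> `(𝒜_u(D) × 𝒜_{n−u}(D̃))/Sp(D) → 𝒜^D_{u,n−u}`. […] *Proof.* […] If `((X, L_X, f_i), (Y, L_Y, g_i))`, `i = 1, 2`,
> are two pairs that induce the same ppav, then by descent theory for abelian varieties, the subgroups of `X × Y`
> (that is, the graphs) induced by `g₁⁻¹εf₁` and `g₂⁻¹εf₂` must be equal. Therefore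
> `(f₂, g₂) = ((εg₂g₁⁻¹ε)f₁, (εg₂g₁⁻¹ε)g₁)` and the first part is proved."

## What this file proves (the CONVERSE half of row A4-77)

In the tree's analytic carrier (`Y = ComplexTorus Φ₁` on `E₁`, `Z = ComplexTorus Φ₂` on `E₂`, `K₁ ⊆ Y`, `K₂ ⊆ Z`
subgroups, `p : K₁ → K₂` with finite graph, `X_p = (Y × Z)/graph(p) = quotientByPeriod (prodPeriod Φ₁ Φ₂) (graphSubgroup K₁ K₂ p)`
with projection `π = ρ(quotientMatrix …)`; primed copies `Y'`, `Z'`, `p'`, `X_{p'}`, `π'`):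

* §1 two elementary lemmas: a real number divisible by every positive integer (in `ℤ`) is `0`; an `ℝ`-linear
  functional with integer values vanishes (private `linearMap_eq_zero_of_forall_exists_int`);
* §2 (`snd_eq_zero_of_forall_cover_mem_map_subtorus_fstSubspace` and its `0 × Z'` twin): an `ℝ`-linear map into
  the covering space `E₁' × E₂'` of `X_{p'}` whose values cover points of `π'(Y' × 0)` takes values in `E₁' × 0`
  (the lattice of `X_{p'}` meets `E₁' × E₂'` in a group whose projection to the `Z'`-coordinates is discrete,
  `⊆ (1/N') ℤ`, and a linear functional into `(1/N') ℤ` is zero);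
* §3 (`exists_latticeVec_of_inl_mem_lattice` and twin): `π'` is injective on `Y' × 0` at lattice level — a vector
  `(v, 0)` of the lattice of `X_{p'}` has `v ∈ Λ_{Y'}` (A4-76 FILE A
  `eq_zero_of_mem_subtorus_fstSubspace_of_mapMatrix_quotientBy_eq_zero`, for `p'` injective);
* §4 (`exists_prodMap_of_analyticRep`): the analytic representation `C : E₁ × E₂ ⥲ E₁' × E₂'` of an isomorphism of
  POLARISED tori `k : (X_p, ω₁ ⊞ ω₂) ⥲ (X_{p'}, ω₁' ⊞ ω₂')` carrying `π(Y × 0)` onto `π'(Y' × 0)` and `π(0 × Z)` onto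
  `π'(0 × Z')` is a product `C = F₁ × F₂` of `ℂ`-linear isomorphisms preserving `ω₁`, `ω₂`;
* §5 MAIN (`exists_isPolarizedIso_factors_of_isPolarizedIso_quotientBy_graphSubgroup`): such a `k` is induced by
  isomorphisms of POLARISED tori `α : (Y, ω₁) ⥲ (Y', ω₁')`, `β : (Z, ω₂) ⥲ (Z', ω₂')` — `k ∘ π = π' ∘ (α × β)` — and
  (for `p`, `p'` bijective) `α(K₁) = K₁'`, `β(K₂) = K₂'` and **`p' ∘ α|_K = β|_K ∘ p`** ("the graphs … must be
  equal. Therefore …"): ISOMORPHIC TRIPLES `(X_p ⊃ Y, Z) ≅ (X_{p'} ⊃ Y', Z')` COME FROM ISOMORPHIC DATA;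
* §6 the IFF (`exists_isPolarizedIso_quotientBy_graphSubgroup_iff`, with FILE H for the other direction): for
  bijections `p`, `p'` with finite graphs, `(X_p, ω₁ ⊞ ω₂) ≅ (X_{p'}, ω₁' ⊞ ω₂')` AS TRIPLES iff there are
  polarised isomorphisms `α`, `β` of the factors with `p' ∘ α|_K = β|_K ∘ p` — the torus-level statement of
  "`𝒜'_{u,g−u,δ}` parametrizes triplets `(X, Y, Z, θ)`" / Thm. 3.5's description of the fibres of `Φ_{u,n−u}(D)`;
  for `(Y, Z) = (Y', Z')` it says that the isomorphism class of the TRIPLE depends exactly on the double coset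
  `Aut(Z, θ_Z)|_K · p · Aut(Y, θ_Y)|_K` of `p` (scope note of FILE H: the bare clause "does not depend on `p`" is
  not asserted for fixed factors).

THEOREMS ONLY; no definition, no named fact, net debt `0`.

## References

* [IribarLopez2024NoetherLefschetzCycles] A. Iribar López, *Noether–Lefschetz cycles on the moduli space of abelian
  varieties*, Forum Math. Pi (2026), arXiv:2411.09910, §2.2 Lemma 10 (p. 7), Def. 4 (p. 8).
* [Auffarth2016NonSimplePPAV] R. Auffarth, *On a numerical characterization of non-simple principally polarized
  abelian varieties*, Math. Z. 282 (2016) 731–746, arXiv:1507.08618, §3 Thm. 3.5 and proof (pp. 9–10).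
* [Lange2023AbelianVarietiesComplex] H. Lange, *Abelian Varieties over the Complex Numbers* (2023), §1.1.2 Prop. 1.1.6
  and (1.2) (pp. 19–20: analytic and rational representations), "`X/Γ = V/π⁻¹(Γ)`" (p. 21), §2.4.4 Cor. 2.4.24,
  §3.1.2 Prop. 3.1.4.
* [LangeBirkenhake1992] H. Lange, Ch. Birkenhake, *Complex Abelian Varieties* (1992), §1.1.2 (faithfulness of `ρ_r`).
-/

noncomputable section

open Complex Module Function Matrix
open scoped Manifold

namespace Literature.Geometry.Kaehler

namespace ComplexTorus

/-- `(B A)_ℝ = B_ℝ A_ℝ` for integer matrices. [folklore] -/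
private theorem map_intCast_mul_TPI {m κ n : Type*} [Fintype κ] (B : Matrix m κ ℤ) (A : Matrix κ n ℤ) :
    (B * A).map (Int.cast : ℤ → ℝ) = B.map (Int.cast : ℤ → ℝ) * A.map (Int.cast : ℤ → ℝ) :=
  Matrix.map_mul (f := Int.castRingHom ℝ)

/-- `A_ℝ m = A m` on integer vectors. [folklore] -/
private theorem map_mulVec_intVec_TPI {m n : Type*} [Fintype n] (A : Matrix m n ℤ) (v : n → ℤ) :
    (A.map (Int.cast : ℤ → ℝ)) *ᵥ intVec v = intVec (A *ᵥ v) := by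
  funext i
  simp [Matrix.mulVec, dotProduct, intVec]

/-- `(N · 1)_ℝ v = N v`. [folklore] -/
private theorem map_natCast_smul_one_mulVec_TPI {n : Type*} [Fintype n] [DecidableEq n] (N : ℕ) (v : n → ℝ) :
    ((N : ℤ) • (1 : Matrix n n ℤ)).map (Int.cast : ℤ → ℝ) *ᵥ v = (N : ℝ) • v := by
  have h : ((N : ℤ) • (1 : Matrix n n ℤ)).map (Int.cast : ℤ → ℝ) = (N : ℝ) • (1 : Matrix n n ℝ) := by
    ext i j
    rw [Matrix.map_apply, Matrix.smul_apply, Matrix.smul_apply, Matrix.one_apply, Matrix.one_apply]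
    split_ifs <;> simp
  rw [h, Matrix.smul_mulVec, Matrix.one_mulVec]

/-- `(f × g)(x) = (f x₁, g x₂)`. [folklore] -/
private theorem prodMap_apply_TPI {M₁ M₂ N₁ N₂ : Type*} [TopologicalSpace M₁] [AddCommMonoid M₁] [Module ℂ M₁]
    [TopologicalSpace M₂] [AddCommMonoid M₂] [Module ℂ M₂] [TopologicalSpace N₁] [AddCommMonoid N₁] [Module ℂ N₁]
    [TopologicalSpace N₂] [AddCommMonoid N₂] [Module ℂ N₂] (f : M₁ →L[ℂ] N₁) (g : M₂ →L[ℂ] N₂) (x : M₁ × M₂) :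
    (f.prodMap g) x = (f x.1, g x.2) := rfl

/-- `e⁻¹(e(S)) = S` for subgroups. [folklore] -/
private theorem map_map_symm_TPI {G H : Type*} [AddGroup G] [AddGroup H] (e : G ≃+ H) (S : AddSubgroup G) :
    (S.map e.toAddMonoidHom).map e.symm.toAddMonoidHom = S := by
  ext x
  constructor
  · rintro ⟨y, ⟨z, hz, rfl⟩, rfl⟩
    simpa using hz
  · intro hx
    exact ⟨e x, ⟨x, hx, rfl⟩, e.symm_apply_apply x⟩

/-! ### §1 A linear functional with integer values vanishes -/

section Divisible

/-- **A real number divisible in `ℤ` by every positive integer is `0`**: if `x = k z_k` with `z_k ∈ ℤ` for all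
`k ≥ 1` then `x = 0` (take `k > |x|`). [folklore] -/
private theorem eq_zero_of_forall_exists_eq_natCast_mul_intCast {x : ℝ}
    (h : ∀ k : ℕ, 0 < k → ∃ z : ℤ, x = k * z) : x = 0 := by
  obtain ⟨z, hz⟩ := h (⌊|x|⌋₊ + 1) (Nat.succ_pos _)
  by_contra hx
  have hz0 : z ≠ 0 := by
    rintro rfl
    rw [Int.cast_zero, mul_zero] at hz
    exact hx hz
  have h1 : (1 : ℝ) ≤ |(z : ℝ)| := by
    rw [← Int.cast_abs, ← Int.cast_one, Int.cast_le]
    exact Int.one_le_abs hz0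
  have h2 : |x| < ((⌊|x|⌋₊ + 1 : ℕ) : ℝ) := by
    push_cast
    exact Nat.lt_floor_add_one |x|
  have h3 : |x| = ((⌊|x|⌋₊ + 1 : ℕ) : ℝ) * |(z : ℝ)| := by
    rw [← Nat.abs_cast (⌊|x|⌋₊ + 1), ← abs_mul, ← hz]
  have h4 : ((⌊|x|⌋₊ + 1 : ℕ) : ℝ) * 1 ≤ ((⌊|x|⌋₊ + 1 : ℕ) : ℝ) * |(z : ℝ)| :=
    mul_le_mul_of_nonneg_left h1 (Nat.cast_nonneg _)
  linarith

/-- **An `ℝ`-linear functional taking only integer values is zero** (`f v = k · f(v/k) ∈ k ℤ` for every `k`;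
equivalently: the divisible part `⋂ₖ k(S + Λ)` of "subspace + finitely generated group" is the subspace `S` —
the identity component of the preimage of a sub-torus). [folklore] -/
private theorem linearMap_eq_zero_of_forall_exists_int {V : Type*} [AddCommGroup V] [Module ℝ V] (f : V →ₗ[ℝ] ℝ)
    (h : ∀ v, ∃ z : ℤ, f v = z) : f = 0 := by
  refine LinearMap.ext fun v ↦ ?_
  rw [LinearMap.zero_apply]
  refine eq_zero_of_forall_exists_eq_natCast_mul_intCast fun k hk ↦ ?_
  obtain ⟨z, hz⟩ := h ((k : ℝ)⁻¹ • v)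
  refine ⟨z, ?_⟩
  have hk' : (k : ℝ) ≠ 0 := Nat.cast_ne_zero.2 hk.ne'
  rw [← hz, map_smul, smul_eq_mul, ← mul_assoc, mul_inv_cancel₀ hk', one_mul]

end Divisible

/-! ### §2 Linear maps covering points of `π'(Y' × 0)` take values in `E₁' × 0` (and the `0 × Z'` twin) -/

section Cover

variable {ι₁' ι₂' : Type*} [Fintype ι₁'] [Fintype ι₂'] [DecidableEq ι₁'] [DecidableEq ι₂']
  {E₁' E₂' : Type*} [NormedAddCommGroup E₁'] [NormedSpace ℂ E₁'] [NormedAddCommGroup E₂'] [NormedSpace ℂ E₂']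
  (Φ₁' : (ι₁' → ℝ) ≃L[ℝ] E₁') (Φ₂' : (ι₂' → ℝ) ≃L[ℝ] E₂')
  (Γ' : AddSubgroup (ComplexTorus (prodPeriod Φ₁' Φ₂'))) [Finite Γ']
  {V : Type*} [AddCommGroup V] [Module ℝ V]

/-- In the covering space of `X' = (Y' × Z')/Γ'` (period isomorphism `Ψ' = quotientByPeriod`), a vector `y`
covering a point of `π'(Y' × 0)` is `Q' x' + n` with `x' ∈ ℝ^{ι₁'} × 0` and `n ∈ ℤ^{ι'}`.
[cite: Lange2023AbelianVarietiesComplex, §1.1.2 ("`X/Γ = V/π⁻¹(Γ)`", p. 21) and §2.4.4 Cor. 2.4.24] -/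
theorem exists_eq_quotientMatrix_mulVec_add_intVec_of_proj_mem_map_subtorus {W : Submodule ℝ (ι₁' ⊕ ι₂' → ℝ)}
    {y : ι₁' ⊕ ι₂' → ℝ}
    (hy : proj (quotientByPeriod (prodPeriod Φ₁' Φ₂') Γ') y ∈
      (subtorus (prodPeriod Φ₁' Φ₂') W).map (mapMatrixHom (prodPeriod Φ₁' Φ₂')
        (quotientByPeriod (prodPeriod Φ₁' Φ₂') Γ') (quotientMatrix (prodPeriod Φ₁' Φ₂') Γ'))) :
    ∃ x' ∈ W, ∃ n : ι₁' ⊕ ι₂' → ℤ,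
      y = (quotientMatrix (prodPeriod Φ₁' Φ₂') Γ').map (Int.cast : ℤ → ℝ) *ᵥ x' + intVec n := by
  obtain ⟨t', ht', heq⟩ := AddSubgroup.mem_map.1 hy
  rw [mem_subtorus_iff] at ht'
  obtain ⟨x', hx', rfl⟩ := ht'
  rw [mapMatrixHom_apply, mapMatrix_proj] at heq
  obtain ⟨n, hn⟩ := (proj_eq_proj_iff_exists_intVec (quotientByPeriod (prodPeriod Φ₁' Φ₂') Γ')).1 heq
  exact ⟨x', hx', n, hn⟩

/-- `y = (1/N') Q'(B' y)` and hence `Ψ' y = (Φ₁' × Φ₂')((1/N') B' y)` for the basis matrix `B'` of `N' · π'⁻¹(Γ')`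
(`Q' B' = N' · 1`). [cite: Lange2023AbelianVarietiesComplex, §1.1.2 ("`X/Γ = V/π⁻¹(Γ)`", p. 21)] -/
theorem quotientByPeriod_eq_prodPeriod_liftLatticeMatrix_mulVec (y : ι₁' ⊕ ι₂' → ℝ) :
    quotientByPeriod (prodPeriod Φ₁' Φ₂') Γ' y = prodPeriod Φ₁' Φ₂'
      ((Nat.card Γ' : ℝ)⁻¹ • ((liftLatticeMatrix (prodPeriod Φ₁' Φ₂') Γ').map (Int.cast : ℤ → ℝ) *ᵥ y)) := by
  have hN : (Nat.card Γ' : ℝ) ≠ 0 := Nat.cast_ne_zero.2 (natCard_subgroup_pos (prodPeriod Φ₁' Φ₂') Γ').ne'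
  have h := quotientPeriod_mulVec (prodPeriod Φ₁' Φ₂') (quotientMatrix (prodPeriod Φ₁' Φ₂') Γ')
    (det_quotientMatrix_ne_zero (prodPeriod Φ₁' Φ₂') Γ')
    ((Nat.card Γ' : ℝ)⁻¹ • ((liftLatticeMatrix (prodPeriod Φ₁' Φ₂') Γ').map (Int.cast : ℤ → ℝ) *ᵥ y))
  rw [Matrix.mulVec_smul, Matrix.mulVec_mulVec, ← map_intCast_mul_TPI, quotientMatrix_mul_liftLatticeMatrix,
    map_natCast_smul_one_mulVec_TPI, smul_smul, inv_mul_cancel₀ hN, one_smul] at h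
  exact h

/-- **A linear map into the covering space of `X'` whose values cover points of `π'(Y' × 0)` takes values in
`E₁' × 0`.**  For `y_v = Ψ'⁻¹(f v) = Q' x'_v + n_v` (`x'_v ∈ ℝ^{ι₁'} × 0`), the `Z'`-coordinates of `B' y_v` are
the integers `(B' n_v)_j` (`B' Q' = N'`); a linear functional with integer values is zero, so
`f v = (Φ₁' × Φ₂')((1/N') B' y_v) ∈ E₁' × 0`.  (This is the identity-component argument "the preimage of the
abelian subvariety `π'(Y' × 0)` in the universal cover is `E₁' × 0` + lattice".)
[cite: Lange2023AbelianVarietiesComplex, §1.1.2 Prop. 1.1.6 (p. 19: lifting to the universal covers) and §2.4.4 Cor. 2.4.24 (p. 123)] [cite: Auffarth2016NonSimplePPAV, §3 Thm. 3.5 (proof)] -/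
theorem snd_eq_zero_of_forall_cover_mem_map_subtorus_fstSubspace (f : V →ₗ[ℝ] E₁' × E₂')
    (hf : ∀ v, proj (quotientByPeriod (prodPeriod Φ₁' Φ₂') Γ')
        ((quotientByPeriod (prodPeriod Φ₁' Φ₂') Γ').symm (f v)) ∈
      (subtorus (prodPeriod Φ₁' Φ₂') (fstSubspace : Submodule ℝ (ι₁' ⊕ ι₂' → ℝ))).map
        (mapMatrixHom (prodPeriod Φ₁' Φ₂') (quotientByPeriod (prodPeriod Φ₁' Φ₂') Γ')
          (quotientMatrix (prodPeriod Φ₁' Φ₂') Γ'))) (v : V) :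
    (f v).2 = 0 := by
  -- the `Z'`-coordinates of `B' Ψ'⁻¹(f v)` are integer-valued linear functionals of `v`, hence `0`
  have h2 : ∀ j, ((liftLatticeMatrix (prodPeriod Φ₁' Φ₂') Γ').map (Int.cast : ℤ → ℝ) *ᵥ
      (quotientByPeriod (prodPeriod Φ₁' Φ₂') Γ').symm (f v)) (Sum.inr j) = 0 := by
    intro j
    let g : V →ₗ[ℝ] ℝ := (LinearMap.proj (Sum.inr j)).comp
      ((Matrix.mulVecLin ((liftLatticeMatrix (prodPeriod Φ₁' Φ₂') Γ').map (Int.cast : ℤ → ℝ))).comp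
        (((quotientByPeriod (prodPeriod Φ₁' Φ₂') Γ').symm : (E₁' × E₂') →L[ℝ] (ι₁' ⊕ ι₂' → ℝ)).toLinearMap.comp f))
    have hg : ∀ w, g w = ((liftLatticeMatrix (prodPeriod Φ₁' Φ₂') Γ').map (Int.cast : ℤ → ℝ) *ᵥ
        (quotientByPeriod (prodPeriod Φ₁' Φ₂') Γ').symm (f w)) (Sum.inr j) := fun w ↦ rfl
    have hint : ∀ w, ∃ z : ℤ, g w = z := by
      intro w
      obtain ⟨x', hx', n, hn⟩ :=
        exists_eq_quotientMatrix_mulVec_add_intVec_of_proj_mem_map_subtorus Φ₁' Φ₂' Γ' (hf w)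
      refine ⟨(liftLatticeMatrix (prodPeriod Φ₁' Φ₂') Γ' *ᵥ n) (Sum.inr j), ?_⟩
      rw [hg, hn, Matrix.mulVec_add, Matrix.mulVec_mulVec, ← map_intCast_mul_TPI,
        liftLatticeMatrix_mul_quotientMatrix, map_natCast_smul_one_mulVec_TPI, map_mulVec_intVec_TPI,
        Pi.add_apply, Pi.smul_apply, (mem_fstSubspace_iff x').1 hx' j, smul_zero, zero_add]
      rfl
    have hg0 := linearMap_eq_zero_of_forall_exists_int g hint
    rw [← hg, hg0, LinearMap.zero_apply]
  have h3 := quotientByPeriod_eq_prodPeriod_liftLatticeMatrix_mulVec Φ₁' Φ₂' Γ'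
    ((quotientByPeriod (prodPeriod Φ₁' Φ₂') Γ').symm (f v))
  rw [ContinuousLinearEquiv.apply_symm_apply] at h3
  rw [h3, prodPeriod_apply]
  dsimp only
  have h0 : (fun j ↦ ((Nat.card Γ' : ℝ)⁻¹ • ((liftLatticeMatrix (prodPeriod Φ₁' Φ₂') Γ').map (Int.cast : ℤ → ℝ) *ᵥ
      (quotientByPeriod (prodPeriod Φ₁' Φ₂') Γ').symm (f v))) (Sum.inr j)) = 0 := by
    funext j
    rw [Pi.smul_apply, h2 j, smul_zero, Pi.zero_apply]
  rw [h0, map_zero]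

/-- **The `0 × Z'` twin**: a linear map whose values cover points of `π'(0 × Z')` takes values in `0 × E₂'`.
[cite: Lange2023AbelianVarietiesComplex, §1.1.2 Prop. 1.1.6 (p. 19) and §2.4.4 Cor. 2.4.24 (p. 123)] [cite: Auffarth2016NonSimplePPAV, §3 Thm. 3.5 (proof)] -/
theorem fst_eq_zero_of_forall_cover_mem_map_subtorus_sndSubspace (f : V →ₗ[ℝ] E₁' × E₂')
    (hf : ∀ v, proj (quotientByPeriod (prodPeriod Φ₁' Φ₂') Γ')
        ((quotientByPeriod (prodPeriod Φ₁' Φ₂') Γ').symm (f v)) ∈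
      (subtorus (prodPeriod Φ₁' Φ₂') (sndSubspace : Submodule ℝ (ι₁' ⊕ ι₂' → ℝ))).map
        (mapMatrixHom (prodPeriod Φ₁' Φ₂') (quotientByPeriod (prodPeriod Φ₁' Φ₂') Γ')
          (quotientMatrix (prodPeriod Φ₁' Φ₂') Γ'))) (v : V) :
    (f v).1 = 0 := by
  have h2 : ∀ i, ((liftLatticeMatrix (prodPeriod Φ₁' Φ₂') Γ').map (Int.cast : ℤ → ℝ) *ᵥ
      (quotientByPeriod (prodPeriod Φ₁' Φ₂') Γ').symm (f v)) (Sum.inl i) = 0 := by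
    intro i
    let g : V →ₗ[ℝ] ℝ := (LinearMap.proj (Sum.inl i)).comp
      ((Matrix.mulVecLin ((liftLatticeMatrix (prodPeriod Φ₁' Φ₂') Γ').map (Int.cast : ℤ → ℝ))).comp
        (((quotientByPeriod (prodPeriod Φ₁' Φ₂') Γ').symm : (E₁' × E₂') →L[ℝ] (ι₁' ⊕ ι₂' → ℝ)).toLinearMap.comp f))
    have hg : ∀ w, g w = ((liftLatticeMatrix (prodPeriod Φ₁' Φ₂') Γ').map (Int.cast : ℤ → ℝ) *ᵥ
        (quotientByPeriod (prodPeriod Φ₁' Φ₂') Γ').symm (f w)) (Sum.inl i) := fun w ↦ rfl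
    have hint : ∀ w, ∃ z : ℤ, g w = z := by
      intro w
      obtain ⟨x', hx', n, hn⟩ :=
        exists_eq_quotientMatrix_mulVec_add_intVec_of_proj_mem_map_subtorus Φ₁' Φ₂' Γ' (hf w)
      refine ⟨(liftLatticeMatrix (prodPeriod Φ₁' Φ₂') Γ' *ᵥ n) (Sum.inl i), ?_⟩
      rw [hg, hn, Matrix.mulVec_add, Matrix.mulVec_mulVec, ← map_intCast_mul_TPI,
        liftLatticeMatrix_mul_quotientMatrix, map_natCast_smul_one_mulVec_TPI, map_mulVec_intVec_TPI,
        Pi.add_apply, Pi.smul_apply, (mem_sndSubspace_iff x').1 hx' i, smul_zero, zero_add]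
      rfl
    have hg0 := linearMap_eq_zero_of_forall_exists_int g hint
    rw [← hg, hg0, LinearMap.zero_apply]
  have h3 := quotientByPeriod_eq_prodPeriod_liftLatticeMatrix_mulVec Φ₁' Φ₂' Γ'
    ((quotientByPeriod (prodPeriod Φ₁' Φ₂') Γ').symm (f v))
  rw [ContinuousLinearEquiv.apply_symm_apply] at h3
  rw [h3, prodPeriod_apply]
  dsimp only
  have h0 : (fun i ↦ ((Nat.card Γ' : ℝ)⁻¹ • ((liftLatticeMatrix (prodPeriod Φ₁' Φ₂') Γ').map (Int.cast : ℤ → ℝ) *ᵥ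
      (quotientByPeriod (prodPeriod Φ₁' Φ₂') Γ').symm (f v))) (Sum.inl i)) = 0 := by
    funext i
    rw [Pi.smul_apply, h2 i, smul_zero, Pi.zero_apply]
  rw [h0, map_zero]

end Cover

/-! ### §3 `π'` is injective on `Y' × 0` and on `0 × Z'` at lattice level -/

section Lattice

variable {ι₁' ι₂' : Type*} [Fintype ι₁'] [Fintype ι₂'] [DecidableEq ι₁'] [DecidableEq ι₂']
  {E₁' E₂' : Type*} [NormedAddCommGroup E₁'] [NormedSpace ℂ E₁'] [NormedAddCommGroup E₂'] [NormedSpace ℂ E₂']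
  (Φ₁' : (ι₁' → ℝ) ≃L[ℝ] E₁') (Φ₂' : (ι₂' → ℝ) ≃L[ℝ] E₂')
  {K₁' : AddSubgroup (ComplexTorus Φ₁')} {K₂' : AddSubgroup (ComplexTorus Φ₂')} (p' : K₁' →+ K₂')
  [Finite (graphSubgroup K₁' K₂' p')]

/-- **`Λ_{X'} ∩ (E₁' × 0) = Λ_{Y'} × 0`**: if a lattice vector `Ψ'(n')` of `X' = (Y' × Z')/graph(p')` (`p'` injective)
lies in `E₁' × 0`, its first component is a lattice vector of `Y'` — `π'|_{Y' × 0}` is injective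
(`graph(p') ∩ (Y' × 0) = 0`). [cite: Auffarth2016NonSimplePPAV, §3, proof of Lemma 3.7 ("`H ∩ X × {0} = {(0,0)}`")] [cite: IribarLopez2024NoetherLefschetzCycles, §2.2 Lemma 10 ("contains `(Y, θ_Y)`")] -/
theorem exists_latticeVec_of_inl_mem_lattice (hp' : Injective p') {v : E₁'} {n' : ι₁' ⊕ ι₂' → ℤ}
    (hv : quotientByPeriod (prodPeriod Φ₁' Φ₂') (graphSubgroup K₁' K₂' p') (intVec n') = (v, 0)) :
    ∃ m₁ : ι₁' → ℤ, v = latticeVec Φ₁' m₁ := by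
  set ξ : ι₁' ⊕ ι₂' → ℝ := (Nat.card (graphSubgroup K₁' K₂' p') : ℝ)⁻¹ •
    ((liftLatticeMatrix (prodPeriod Φ₁' Φ₂') (graphSubgroup K₁' K₂' p')).map (Int.cast : ℤ → ℝ) *ᵥ intVec n')
    with hξ
  have hN : (Nat.card (graphSubgroup K₁' K₂' p') : ℝ) ≠ 0 :=
    Nat.cast_ne_zero.2 (natCard_subgroup_pos (prodPeriod Φ₁' Φ₂') _).ne'
  -- `Q' ξ = n'` and `(Φ₁' × Φ₂') ξ = (v, 0)`
  have hQξ : (quotientMatrix (prodPeriod Φ₁' Φ₂') (graphSubgroup K₁' K₂' p')).map (Int.cast : ℤ → ℝ) *ᵥ ξ =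
      intVec n' := by
    rw [hξ, Matrix.mulVec_smul, Matrix.mulVec_mulVec, ← map_intCast_mul_TPI, quotientMatrix_mul_liftLatticeMatrix,
      map_natCast_smul_one_mulVec_TPI, smul_smul, inv_mul_cancel₀ hN, one_smul]
  have hPξ : prodPeriod Φ₁' Φ₂' ξ = (v, 0) := by
    rw [← hv, hξ, ← quotientByPeriod_eq_prodPeriod_liftLatticeMatrix_mulVec]
  -- `ξ ∈ ℝ^{ι₁'} × 0`
  have hξfst : ξ ∈ (fstSubspace : Submodule ℝ (ι₁' ⊕ ι₂' → ℝ)) := by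
    rw [mem_fstSubspace_iff]
    have h2 := congrArg Prod.snd hPξ
    rw [prodPeriod_apply] at h2
    dsimp only at h2
    have h2' : (fun j ↦ ξ (Sum.inr j)) = 0 := Φ₂'.injective (by rw [map_zero]; exact h2)
    exact fun j ↦ congrFun h2' j
  -- `π'(proj ξ) = proj (Q' ξ) = proj n' = 0`, and `π'` is injective on `Y' × 0`
  have hπ : mapMatrix (prodPeriod Φ₁' Φ₂') (quotientByPeriod (prodPeriod Φ₁' Φ₂') (graphSubgroup K₁' K₂' p'))
      (quotientMatrix (prodPeriod Φ₁' Φ₂') (graphSubgroup K₁' K₂' p')) (proj (prodPeriod Φ₁' Φ₂') ξ) = 0 := by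
    rw [mapMatrix_proj, hQξ, proj_intVec]
  have hmem : proj (prodPeriod Φ₁' Φ₂') ξ ∈
      subtorus (prodPeriod Φ₁' Φ₂') (fstSubspace : Submodule ℝ (ι₁' ⊕ ι₂' → ℝ)) := by
    rw [mem_subtorus_iff]
    exact ⟨ξ, hξfst, rfl⟩
  have h0 := eq_zero_of_mem_subtorus_fstSubspace_of_mapMatrix_quotientBy_eq_zero p' hp' hmem hπ
  obtain ⟨m, hm⟩ := (proj_eq_zero_iff (prodPeriod Φ₁' Φ₂')).1 h0
  refine ⟨fun i ↦ m (Sum.inl i), ?_⟩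
  have h1 := congrArg Prod.fst hPξ
  rw [prodPeriod_apply] at h1
  dsimp only at h1
  rw [← h1, hm]
  rfl

/-- **`Λ_{X'} ∩ (0 × E₂') = 0 × Λ_{Z'}`** (`graph(p') ∩ (0 × Z') = 0`, no injectivity needed).
[cite: Auffarth2016NonSimplePPAV, §3, proof of Lemma 3.7 ("`H ∩ {0} × Y = {(0,0)}`")] [cite: IribarLopez2024NoetherLefschetzCycles, §2.2 Lemma 10 ("contains `(Z, θ_Z)`")] -/
theorem exists_latticeVec_of_inr_mem_lattice {w : E₂'} {n' : ι₁' ⊕ ι₂' → ℤ}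
    (hw : quotientByPeriod (prodPeriod Φ₁' Φ₂') (graphSubgroup K₁' K₂' p') (intVec n') = (0, w)) :
    ∃ m₂ : ι₂' → ℤ, w = latticeVec Φ₂' m₂ := by
  set ξ : ι₁' ⊕ ι₂' → ℝ := (Nat.card (graphSubgroup K₁' K₂' p') : ℝ)⁻¹ •
    ((liftLatticeMatrix (prodPeriod Φ₁' Φ₂') (graphSubgroup K₁' K₂' p')).map (Int.cast : ℤ → ℝ) *ᵥ intVec n')
    with hξ
  have hN : (Nat.card (graphSubgroup K₁' K₂' p') : ℝ) ≠ 0 :=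
    Nat.cast_ne_zero.2 (natCard_subgroup_pos (prodPeriod Φ₁' Φ₂') _).ne'
  have hQξ : (quotientMatrix (prodPeriod Φ₁' Φ₂') (graphSubgroup K₁' K₂' p')).map (Int.cast : ℤ → ℝ) *ᵥ ξ =
      intVec n' := by
    rw [hξ, Matrix.mulVec_smul, Matrix.mulVec_mulVec, ← map_intCast_mul_TPI, quotientMatrix_mul_liftLatticeMatrix,
      map_natCast_smul_one_mulVec_TPI, smul_smul, inv_mul_cancel₀ hN, one_smul]
  have hPξ : prodPeriod Φ₁' Φ₂' ξ = (0, w) := by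
    rw [← hw, hξ, ← quotientByPeriod_eq_prodPeriod_liftLatticeMatrix_mulVec]
  have hξsnd : ξ ∈ (sndSubspace : Submodule ℝ (ι₁' ⊕ ι₂' → ℝ)) := by
    rw [mem_sndSubspace_iff]
    have h1 := congrArg Prod.fst hPξ
    rw [prodPeriod_apply] at h1
    dsimp only at h1
    have h1' : (fun i ↦ ξ (Sum.inl i)) = 0 := Φ₁'.injective (by rw [map_zero]; exact h1)
    exact fun i ↦ congrFun h1' i
  have hπ : mapMatrix (prodPeriod Φ₁' Φ₂') (quotientByPeriod (prodPeriod Φ₁' Φ₂') (graphSubgroup K₁' K₂' p'))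
      (quotientMatrix (prodPeriod Φ₁' Φ₂') (graphSubgroup K₁' K₂' p')) (proj (prodPeriod Φ₁' Φ₂') ξ) = 0 := by
    rw [mapMatrix_proj, hQξ, proj_intVec]
  have hmem : proj (prodPeriod Φ₁' Φ₂') ξ ∈
      subtorus (prodPeriod Φ₁' Φ₂') (sndSubspace : Submodule ℝ (ι₁' ⊕ ι₂' → ℝ)) := by
    rw [mem_subtorus_iff]
    exact ⟨ξ, hξsnd, rfl⟩
  have h0 := eq_zero_of_mem_subtorus_sndSubspace_of_mapMatrix_quotientBy_eq_zero p' hmem hπ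
  obtain ⟨m, hm⟩ := (proj_eq_zero_iff (prodPeriod Φ₁' Φ₂')).1 h0
  refine ⟨fun j ↦ m (Sum.inr j), ?_⟩
  have h2 := congrArg Prod.snd hPξ
  rw [prodPeriod_apply] at h2
  dsimp only at h2
  rw [← h2, hm]
  rfl

end Lattice

/-! ### §4 The analytic representation of an isomorphism of triples is a product `F₁ × F₂` -/

section Analytic

variable {E₁ E₂ E₁' E₂' : Type*} [NormedAddCommGroup E₁] [NormedSpace ℂ E₁] [NormedAddCommGroup E₂] [NormedSpace ℂ E₂]
  [NormedAddCommGroup E₁'] [NormedSpace ℂ E₁'] [NormedAddCommGroup E₂'] [NormedSpace ℂ E₂']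

/-- **A `ℂ`-linear isomorphism `C : E₁ × E₂ ⥲ E₁' × E₂'` with `C(E₁ × 0) ⊆ E₁' × 0`, `C(0 × E₂) ⊆ 0 × E₂'` and the
same for `C⁻¹` is a product `F₁ × F₂` of `ℂ`-linear isomorphisms.** [folklore] -/
private theorem exists_prodMap_of_components (C : (E₁ × E₂) ≃L[ℂ] (E₁' × E₂'))
    (h12 : ∀ u, (C (u, 0)).2 = 0) (h21 : ∀ w, (C (0, w)).1 = 0)
    (h12' : ∀ u', (C.symm (u', 0)).2 = 0) (h21' : ∀ w', (C.symm (0, w')).1 = 0) :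
    ∃ (F₁ : E₁ ≃L[ℂ] E₁') (F₂ : E₂ ≃L[ℂ] E₂'), ∀ u w, C (u, w) = (F₁ u, F₂ w) := by
  -- the four corner maps
  let f₁ : E₁ →L[ℂ] E₁' := (ContinuousLinearMap.fst ℂ E₁' E₂').comp
    ((C : (E₁ × E₂) →L[ℂ] (E₁' × E₂')).comp (ContinuousLinearMap.inl ℂ E₁ E₂))
  let g₁ : E₁' →L[ℂ] E₁ := (ContinuousLinearMap.fst ℂ E₁ E₂).comp
    ((C.symm : (E₁' × E₂') →L[ℂ] (E₁ × E₂)).comp (ContinuousLinearMap.inl ℂ E₁' E₂'))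
  let f₂ : E₂ →L[ℂ] E₂' := (ContinuousLinearMap.snd ℂ E₁' E₂').comp
    ((C : (E₁ × E₂) →L[ℂ] (E₁' × E₂')).comp (ContinuousLinearMap.inr ℂ E₁ E₂))
  let g₂ : E₂' →L[ℂ] E₂ := (ContinuousLinearMap.snd ℂ E₁ E₂).comp
    ((C.symm : (E₁' × E₂') →L[ℂ] (E₁ × E₂)).comp (ContinuousLinearMap.inr ℂ E₁' E₂'))
  have hf₁ : ∀ u, C (u, 0) = (f₁ u, 0) := fun u ↦ Prod.ext rfl (h12 u)
  have hg₁ : ∀ u', C.symm (u', 0) = (g₁ u', 0) := fun u' ↦ Prod.ext rfl (h12' u')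
  have hf₂ : ∀ w, C (0, w) = (0, f₂ w) := fun w ↦ Prod.ext (h21 w) rfl
  have hg₂ : ∀ w', C.symm (0, w') = (0, g₂ w') := fun w' ↦ Prod.ext (h21' w') rfl
  have hfg₁ : ∀ u', f₁ (g₁ u') = u' := fun u' ↦ by
    have h := C.apply_symm_apply (u', 0)
    rw [hg₁, hf₁] at h
    exact congrArg Prod.fst h
  have hgf₁ : ∀ u, g₁ (f₁ u) = u := fun u ↦ by
    have h := C.symm_apply_apply (u, 0)
    rw [hf₁, hg₁] at h
    exact congrArg Prod.fst h
  have hfg₂ : ∀ w', f₂ (g₂ w') = w' := fun w' ↦ by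
    have h := C.apply_symm_apply (0, w')
    rw [hg₂, hf₂] at h
    exact congrArg Prod.snd h
  have hgf₂ : ∀ w, g₂ (f₂ w) = w := fun w ↦ by
    have h := C.symm_apply_apply (0, w)
    rw [hf₂, hg₂] at h
    exact congrArg Prod.snd h
  refine ⟨ContinuousLinearEquiv.equivOfInverse f₁ g₁ hgf₁ hfg₁, ContinuousLinearEquiv.equivOfInverse f₂ g₂ hgf₂ hfg₂,
    fun u w ↦ ?_⟩
  rw [ContinuousLinearEquiv.equivOfInverse_apply, ContinuousLinearEquiv.equivOfInverse_apply]
  have h : ((u, w) : E₁ × E₂) = (u, 0) + (0, w) := by simp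
  rw [h, map_add, hf₁, hf₂, Prod.mk_add_mk, add_zero, zero_add]

end Analytic

/-! ### §5 Isomorphisms of triples come from isomorphisms of the factors -/

section Main

variable {ι₁ ι₂ ι₁' ι₂' : Type*} [Fintype ι₁] [Fintype ι₂] [Fintype ι₁'] [Fintype ι₂']
  [DecidableEq ι₁] [DecidableEq ι₂] [DecidableEq ι₁'] [DecidableEq ι₂']
  {E₁ E₂ E₁' E₂' : Type*} [NormedAddCommGroup E₁] [NormedSpace ℂ E₁] [NormedAddCommGroup E₂] [NormedSpace ℂ E₂]
  [NormedAddCommGroup E₁'] [NormedSpace ℂ E₁'] [NormedAddCommGroup E₂'] [NormedSpace ℂ E₂']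
  {Φ₁ : (ι₁ → ℝ) ≃L[ℝ] E₁} {Φ₂ : (ι₂ → ℝ) ≃L[ℝ] E₂} {Φ₁' : (ι₁' → ℝ) ≃L[ℝ] E₁'} {Φ₂' : (ι₂' → ℝ) ≃L[ℝ] E₂'}
  {ω₁ : E₁ [⋀^Fin 2]→L[ℝ] ℝ} {ω₂ : E₂ [⋀^Fin 2]→L[ℝ] ℝ} {ω₁' : E₁' [⋀^Fin 2]→L[ℝ] ℝ} {ω₂' : E₂' [⋀^Fin 2]→L[ℝ] ℝ}
  {K₁ : AddSubgroup (ComplexTorus Φ₁)} {K₂ : AddSubgroup (ComplexTorus Φ₂)}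
  {K₁' : AddSubgroup (ComplexTorus Φ₁')} {K₂' : AddSubgroup (ComplexTorus Φ₂')}
  {p : K₁ →+ K₂} {p' : K₁' →+ K₂'}
  [Finite (graphSubgroup K₁ K₂ p)] [Finite (graphSubgroup K₁' K₂' p')]
  {k : ComplexTorus (quotientByPeriod (prodPeriod Φ₁ Φ₂) (graphSubgroup K₁ K₂ p)) ≃+
    ComplexTorus (quotientByPeriod (prodPeriod Φ₁' Φ₂') (graphSubgroup K₁' K₂' p'))}

/-- The analytic representation `C` of a homomorphism `k ∘ π : Y × Z → X'` in the hypothesis shape of §2: for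
`u ∈ E₁ × E₂`, `Ψ'⁻¹(C u)` covers `k(π(cover u))`. [cite: Lange2023AbelianVarietiesComplex, §1.1.2 Prop. 1.1.6 (p. 19)] -/
theorem proj_symm_analyticRep_eq {A : Matrix (ι₁' ⊕ ι₂') (ι₁ ⊕ ι₂) ℤ}
    (hA : ⇑k = mapMatrix (quotientByPeriod (prodPeriod Φ₁ Φ₂) (graphSubgroup K₁ K₂ p))
      (quotientByPeriod (prodPeriod Φ₁' Φ₂') (graphSubgroup K₁' K₂' p')) A)
    {C : E₁ × E₂ → E₁' × E₂'}
    (hC : ∀ y, quotientByPeriod (prodPeriod Φ₁' Φ₂') (graphSubgroup K₁' K₂' p') ((A.map (Int.cast : ℤ → ℝ)) *ᵥ y) =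
      C (quotientByPeriod (prodPeriod Φ₁ Φ₂) (graphSubgroup K₁ K₂ p) y)) (x : ι₁ ⊕ ι₂ → ℝ) :
    proj (quotientByPeriod (prodPeriod Φ₁' Φ₂') (graphSubgroup K₁' K₂' p'))
        ((quotientByPeriod (prodPeriod Φ₁' Φ₂') (graphSubgroup K₁' K₂' p')).symm (C (prodPeriod Φ₁ Φ₂ x))) =
      k (mapMatrix (prodPeriod Φ₁ Φ₂) (quotientByPeriod (prodPeriod Φ₁ Φ₂) (graphSubgroup K₁ K₂ p))
        (quotientMatrix (prodPeriod Φ₁ Φ₂) (graphSubgroup K₁ K₂ p)) (proj (prodPeriod Φ₁ Φ₂) x)) := by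
  rw [hA, mapMatrix_proj, mapMatrix_proj]
  congr 1
  apply (quotientByPeriod (prodPeriod Φ₁' Φ₂') (graphSubgroup K₁' K₂' p')).injective
  rw [ContinuousLinearEquiv.apply_symm_apply, hC, quotientPeriod_mulVec]

/-- `C ∘ (Φ₁ × Φ₂) = Ψ' ∘ A_ℝ ∘ Q_ℝ`: the analytic representation of `k ∘ π` on lattice coordinates.
[cite: Lange2023AbelianVarietiesComplex, §1.1.2 Prop. 1.1.6 and (1.2) (pp. 19–20)] -/
theorem analyticRep_prodPeriod_eq {A : Matrix (ι₁' ⊕ ι₂') (ι₁ ⊕ ι₂) ℤ}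
    {C : E₁ × E₂ → E₁' × E₂'}
    (hC : ∀ y, quotientByPeriod (prodPeriod Φ₁' Φ₂') (graphSubgroup K₁' K₂' p') ((A.map (Int.cast : ℤ → ℝ)) *ᵥ y) =
      C (quotientByPeriod (prodPeriod Φ₁ Φ₂) (graphSubgroup K₁ K₂ p) y)) (x : ι₁ ⊕ ι₂ → ℝ) :
    C (prodPeriod Φ₁ Φ₂ x) = quotientByPeriod (prodPeriod Φ₁' Φ₂') (graphSubgroup K₁' K₂' p')
      ((A.map (Int.cast : ℤ → ℝ)) *ᵥ ((quotientMatrix (prodPeriod Φ₁ Φ₂) (graphSubgroup K₁ K₂ p)).map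
        (Int.cast : ℤ → ℝ) *ᵥ x)) := by
  rw [hC, quotientPeriod_mulVec]

variable (hk : IsPolarizedIso (quotientByPeriod (prodPeriod Φ₁ Φ₂) (graphSubgroup K₁ K₂ p)) (prodForm ω₁ ω₂)
    (quotientByPeriod (prodPeriod Φ₁' Φ₂') (graphSubgroup K₁' K₂' p')) (prodForm ω₁' ω₂') k)
  (hY : ((subtorus (prodPeriod Φ₁ Φ₂) (fstSubspace : Submodule ℝ (ι₁ ⊕ ι₂ → ℝ))).map
      (mapMatrixHom (prodPeriod Φ₁ Φ₂) (quotientByPeriod (prodPeriod Φ₁ Φ₂) (graphSubgroup K₁ K₂ p))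
        (quotientMatrix (prodPeriod Φ₁ Φ₂) (graphSubgroup K₁ K₂ p)))).map k.toAddMonoidHom =
    (subtorus (prodPeriod Φ₁' Φ₂') (fstSubspace : Submodule ℝ (ι₁' ⊕ ι₂' → ℝ))).map
      (mapMatrixHom (prodPeriod Φ₁' Φ₂') (quotientByPeriod (prodPeriod Φ₁' Φ₂') (graphSubgroup K₁' K₂' p'))
        (quotientMatrix (prodPeriod Φ₁' Φ₂') (graphSubgroup K₁' K₂' p'))))
  (hZ : ((subtorus (prodPeriod Φ₁ Φ₂) (sndSubspace : Submodule ℝ (ι₁ ⊕ ι₂ → ℝ))).map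
      (mapMatrixHom (prodPeriod Φ₁ Φ₂) (quotientByPeriod (prodPeriod Φ₁ Φ₂) (graphSubgroup K₁ K₂ p))
        (quotientMatrix (prodPeriod Φ₁ Φ₂) (graphSubgroup K₁ K₂ p)))).map k.toAddMonoidHom =
    (subtorus (prodPeriod Φ₁' Φ₂') (sndSubspace : Submodule ℝ (ι₁' ⊕ ι₂' → ℝ))).map
      (mapMatrixHom (prodPeriod Φ₁' Φ₂') (quotientByPeriod (prodPeriod Φ₁' Φ₂') (graphSubgroup K₁' K₂' p'))
        (quotientMatrix (prodPeriod Φ₁' Φ₂') (graphSubgroup K₁' K₂' p'))))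

include hk hY hZ in
/-- **The analytic representation of an isomorphism of triples is a product.**  Let
`k : (X_p, ω₁ ⊞ ω₂) ⥲ (X_{p'}, ω₁' ⊞ ω₂')` be an isomorphism of polarised tori with `k(π(Y × 0)) = π'(Y' × 0)` and
`k(π(0 × Z)) = π'(0 × Z')`.  Then `k = ρ(A)` for an integer matrix `A` and its analytic representation
`C : E₁ × E₂ ⥲ E₁' × E₂'` is `F₁ × F₂` for `ℂ`-linear isomorphisms `F₁ : E₁ ⥲ E₁'`, `F₂ : E₂ ⥲ E₂'` with
`F₁^*ω₁' = ω₁`, `F₂^*ω₂' = ω₂` (lift `k` to the universal covers; the lift respects the tangent spaces `E₁ × 0`,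
`0 × E₂` of the complementary pair). [cite: Auffarth2016NonSimplePPAV, §3 Thm. 3.5 (proof)] [cite: Lange2023AbelianVarietiesComplex, §1.1.2 Prop. 1.1.6 (p. 19) and §3.1.2 Prop. 3.1.4 (p. 160)] -/
theorem exists_prodMap_analyticRep_of_isPolarizedIso_quotientBy_graphSubgroup :
    ∃ (A : Matrix (ι₁' ⊕ ι₂') (ι₁ ⊕ ι₂) ℤ) (F₁ : E₁ ≃L[ℂ] E₁') (F₂ : E₂ ≃L[ℂ] E₂'),
      ⇑k = mapMatrix (quotientByPeriod (prodPeriod Φ₁ Φ₂) (graphSubgroup K₁ K₂ p))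
        (quotientByPeriod (prodPeriod Φ₁' Φ₂') (graphSubgroup K₁' K₂' p')) A ∧
      (∀ y, quotientByPeriod (prodPeriod Φ₁' Φ₂') (graphSubgroup K₁' K₂' p') ((A.map (Int.cast : ℤ → ℝ)) *ᵥ y) =
        ((F₁ : E₁ →L[ℂ] E₁').prodMap (F₂ : E₂ →L[ℂ] E₂'))
          (quotientByPeriod (prodPeriod Φ₁ Φ₂) (graphSubgroup K₁ K₂ p) y)) ∧
      (∀ u v : E₁, ω₁' ![F₁ u, F₁ v] = ω₁ ![u, v]) ∧ (∀ u v : E₂, ω₂' ![F₂ u, F₂ v] = ω₂ ![u, v]) := by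
  obtain ⟨A, -, C, -, -, hA, -, hC, hform⟩ := hk.exists_matrix
  obtain ⟨A', -, C', -, -, hA', -, hC'', -⟩ := hk.symm.exists_matrix
  -- `C' = C⁻¹`: `ρ(A') ∘ ρ(A) = k⁻¹ ∘ k = 1`, so `A' A = 1` and `C' ∘ C = id`
  have hA'A : A' * A = 1 := by
    apply mapMatrix_injective (Φ := quotientByPeriod (prodPeriod Φ₁ Φ₂) (graphSubgroup K₁ K₂ p))
      (Φ' := quotientByPeriod (prodPeriod Φ₁ Φ₂) (graphSubgroup K₁ K₂ p))
    funext t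
    rw [← mapMatrix_mapMatrix (Φ' := quotientByPeriod (prodPeriod Φ₁' Φ₂') (graphSubgroup K₁' K₂' p')), ← hA, ← hA',
      mapMatrix_one]
    exact k.symm_apply_apply t
  have hC'C : ∀ u, C' (C u) = u := fun u ↦ by
    obtain ⟨y, rfl⟩ := (quotientByPeriod (prodPeriod Φ₁ Φ₂) (graphSubgroup K₁ K₂ p)).surjective u
    rw [← hC, ← hC'', Matrix.mulVec_mulVec, ← map_intCast_mul_TPI, hA'A,
      Matrix.map_one Int.cast Int.cast_zero Int.cast_one, Matrix.one_mulVec]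
  have hCs : ∀ v, C.symm v = C' v := fun v ↦ by
    rw [← hC'C (C.symm v), C.apply_symm_apply]
  -- §2 applied four times: `C(E₁ × 0) ⊆ E₁' × 0`, `C(0 × E₂) ⊆ 0 × E₂'`, and the same for `C⁻¹`
  have hY' := hY.le
  have hZ' := hZ.le
  have hYs := (show ((subtorus (prodPeriod Φ₁' Φ₂') (fstSubspace : Submodule ℝ (ι₁' ⊕ ι₂' → ℝ))).map
      (mapMatrixHom (prodPeriod Φ₁' Φ₂') (quotientByPeriod (prodPeriod Φ₁' Φ₂') (graphSubgroup K₁' K₂' p'))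
        (quotientMatrix (prodPeriod Φ₁' Φ₂') (graphSubgroup K₁' K₂' p')))).map k.symm.toAddMonoidHom =
    (subtorus (prodPeriod Φ₁ Φ₂) (fstSubspace : Submodule ℝ (ι₁ ⊕ ι₂ → ℝ))).map
      (mapMatrixHom (prodPeriod Φ₁ Φ₂) (quotientByPeriod (prodPeriod Φ₁ Φ₂) (graphSubgroup K₁ K₂ p))
        (quotientMatrix (prodPeriod Φ₁ Φ₂) (graphSubgroup K₁ K₂ p))) by rw [← hY, map_map_symm_TPI]).le
  have hZs := (show ((subtorus (prodPeriod Φ₁' Φ₂') (sndSubspace : Submodule ℝ (ι₁' ⊕ ι₂' → ℝ))).map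
      (mapMatrixHom (prodPeriod Φ₁' Φ₂') (quotientByPeriod (prodPeriod Φ₁' Φ₂') (graphSubgroup K₁' K₂' p'))
        (quotientMatrix (prodPeriod Φ₁' Φ₂') (graphSubgroup K₁' K₂' p')))).map k.symm.toAddMonoidHom =
    (subtorus (prodPeriod Φ₁ Φ₂) (sndSubspace : Submodule ℝ (ι₁ ⊕ ι₂ → ℝ))).map
      (mapMatrixHom (prodPeriod Φ₁ Φ₂) (quotientByPeriod (prodPeriod Φ₁ Φ₂) (graphSubgroup K₁ K₂ p))
        (quotientMatrix (prodPeriod Φ₁ Φ₂) (graphSubgroup K₁ K₂ p))) by rw [← hZ, map_map_symm_TPI]).le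
  have h12 : ∀ u : E₁, (C (u, 0)).2 = 0 := by
    refine snd_eq_zero_of_forall_cover_mem_map_subtorus_fstSubspace Φ₁' Φ₂' (graphSubgroup K₁' K₂' p')
      (((C : (E₁ × E₂) →L[ℂ] (E₁' × E₂')).restrictScalars ℝ).toLinearMap.comp (LinearMap.inl ℝ E₁ E₂)) (fun u ↦ ?_)
    change proj _ ((quotientByPeriod (prodPeriod Φ₁' Φ₂') (graphSubgroup K₁' K₂' p')).symm (C (u, 0))) ∈ _
    have hu : ((u, 0) : E₁ × E₂) = prodPeriod Φ₁ Φ₂ (Sum.elim (Φ₁.symm u) 0) := by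
      rw [prodPeriod_apply]
      refine Prod.ext ?_ ?_
      · change u = Φ₁ (fun i ↦ Φ₁.symm u i); exact (Φ₁.apply_symm_apply u).symm
      · change (0 : E₂) = Φ₂ (fun j ↦ (0 : ι₂ → ℝ) j); exact (map_zero Φ₂).symm
    rw [hu, proj_symm_analyticRep_eq hA hC]
    exact hY' ⟨_, ⟨proj (prodPeriod Φ₁ Φ₂) (Sum.elim (Φ₁.symm u) 0),
      (mem_subtorus_iff (prodPeriod Φ₁ Φ₂)).2 ⟨_, (mem_fstSubspace_iff _).2 fun j ↦ rfl, rfl⟩, rfl⟩, rfl⟩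
  have h21 : ∀ w : E₂, (C (0, w)).1 = 0 := by
    refine fst_eq_zero_of_forall_cover_mem_map_subtorus_sndSubspace Φ₁' Φ₂' (graphSubgroup K₁' K₂' p')
      (((C : (E₁ × E₂) →L[ℂ] (E₁' × E₂')).restrictScalars ℝ).toLinearMap.comp (LinearMap.inr ℝ E₁ E₂)) (fun w ↦ ?_)
    change proj _ ((quotientByPeriod (prodPeriod Φ₁' Φ₂') (graphSubgroup K₁' K₂' p')).symm (C (0, w))) ∈ _
    have hw : ((0, w) : E₁ × E₂) = prodPeriod Φ₁ Φ₂ (Sum.elim 0 (Φ₂.symm w)) := by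
      rw [prodPeriod_apply]
      refine Prod.ext ?_ ?_
      · change (0 : E₁) = Φ₁ (fun i ↦ (0 : ι₁ → ℝ) i); exact (map_zero Φ₁).symm
      · change w = Φ₂ (fun j ↦ Φ₂.symm w j); exact (Φ₂.apply_symm_apply w).symm
    rw [hw, proj_symm_analyticRep_eq hA hC]
    exact hZ' ⟨_, ⟨proj (prodPeriod Φ₁ Φ₂) (Sum.elim 0 (Φ₂.symm w)),
      (mem_subtorus_iff (prodPeriod Φ₁ Φ₂)).2 ⟨_, (mem_sndSubspace_iff _).2 fun i ↦ rfl, rfl⟩, rfl⟩, rfl⟩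
  have h12' : ∀ u' : E₁', (C.symm (u', 0)).2 = 0 := by
    intro u'
    rw [hCs]
    refine snd_eq_zero_of_forall_cover_mem_map_subtorus_fstSubspace Φ₁ Φ₂ (graphSubgroup K₁ K₂ p)
      (((C' : (E₁' × E₂') →L[ℂ] (E₁ × E₂)).restrictScalars ℝ).toLinearMap.comp (LinearMap.inl ℝ E₁' E₂'))
      (fun u' ↦ ?_) u'
    change proj _ ((quotientByPeriod (prodPeriod Φ₁ Φ₂) (graphSubgroup K₁ K₂ p)).symm (C' (u', 0))) ∈ _
    have hu : ((u', 0) : E₁' × E₂') = prodPeriod Φ₁' Φ₂' (Sum.elim (Φ₁'.symm u') 0) := by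
      rw [prodPeriod_apply]
      refine Prod.ext ?_ ?_
      · change u' = Φ₁' (fun i ↦ Φ₁'.symm u' i); exact (Φ₁'.apply_symm_apply u').symm
      · change (0 : E₂') = Φ₂' (fun j ↦ (0 : ι₂' → ℝ) j); exact (map_zero Φ₂').symm
    rw [hu, proj_symm_analyticRep_eq (k := k.symm) hA' hC'']
    exact hYs ⟨_, ⟨proj (prodPeriod Φ₁' Φ₂') (Sum.elim (Φ₁'.symm u') 0),
      (mem_subtorus_iff (prodPeriod Φ₁' Φ₂')).2 ⟨_, (mem_fstSubspace_iff _).2 fun j ↦ rfl, rfl⟩, rfl⟩, rfl⟩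
  have h21' : ∀ w' : E₂', (C.symm (0, w')).1 = 0 := by
    intro w'
    rw [hCs]
    refine fst_eq_zero_of_forall_cover_mem_map_subtorus_sndSubspace Φ₁ Φ₂ (graphSubgroup K₁ K₂ p)
      (((C' : (E₁' × E₂') →L[ℂ] (E₁ × E₂)).restrictScalars ℝ).toLinearMap.comp (LinearMap.inr ℝ E₁' E₂'))
      (fun w' ↦ ?_) w'
    change proj _ ((quotientByPeriod (prodPeriod Φ₁ Φ₂) (graphSubgroup K₁ K₂ p)).symm (C' (0, w'))) ∈ _
    have hw : ((0, w') : E₁' × E₂') = prodPeriod Φ₁' Φ₂' (Sum.elim 0 (Φ₂'.symm w')) := by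
      rw [prodPeriod_apply]
      refine Prod.ext ?_ ?_
      · change (0 : E₁') = Φ₁' (fun i ↦ (0 : ι₁' → ℝ) i); exact (map_zero Φ₁').symm
      · change w' = Φ₂' (fun j ↦ Φ₂'.symm w' j); exact (Φ₂'.apply_symm_apply w').symm
    rw [hw, proj_symm_analyticRep_eq (k := k.symm) hA' hC'']
    exact hZs ⟨_, ⟨proj (prodPeriod Φ₁' Φ₂') (Sum.elim 0 (Φ₂'.symm w')),
      (mem_subtorus_iff (prodPeriod Φ₁' Φ₂')).2 ⟨_, (mem_sndSubspace_iff _).2 fun i ↦ rfl, rfl⟩, rfl⟩, rfl⟩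
  obtain ⟨F₁, F₂, hF⟩ := exists_prodMap_of_components C h12 h21 h12' h21'
  refine ⟨A, F₁, F₂, hA, fun y ↦ ?_, fun u v ↦ ?_, fun u v ↦ ?_⟩
  · rw [hC, prodMap_apply_TPI, ContinuousLinearEquiv.coe_coe, ContinuousLinearEquiv.coe_coe, ← hF]
  · have h := hform (u, 0) (v, 0)
    rw [hF, hF, map_zero, prodForm_apply, prodForm_apply, twoForm_self, twoForm_self, add_zero, add_zero] at h
    exact h
  · have h := hform (0, u) (0, v)
    rw [hF, hF, map_zero, prodForm_apply, prodForm_apply, twoForm_self, twoForm_self, zero_add, zero_add] at h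
    exact h

include hk hY hZ in
/-- **Iribar López 2024, Def. 4 ("`𝒜'_{u,g−u,δ}` parametrizes triplets") / Auffarth 2016, Thm. 3.5 — isomorphic
triples come from isomorphic data.**  Let `p : K₁ → K₂`, `p' : K₁' → K₂'` be INJECTIVE homomorphisms with finite
graphs (`K₁ ⊆ Y`, `K₂ ⊆ Z`, `K₁' ⊆ Y'`, `K₂' ⊆ Z'`), and let
`k : ((Y × Z)/graph(p), ω₁ ⊞ ω₂) ⥲ ((Y' × Z')/graph(p'), ω₁' ⊞ ω₂')` be an isomorphism of polarised tori carrying the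
image of `Y × 0` onto the image of `Y' × 0` and the image of `0 × Z` onto that of `0 × Z'` (an isomorphism of the
TRIPLES).  Then there are isomorphisms of POLARISED tori `α : (Y, ω₁) ⥲ (Y', ω₁')`, `β : (Z, ω₂) ⥲ (Z', ω₂')` whose
product is an isomorphism `(Y × Z, ω₁ ⊞ ω₂) ⥲ (Y' × Z', ω₁' ⊞ ω₂')` with **`k ∘ π = π' ∘ (α × β)`**; consequently
`(α × β)(graph p) = graph p'` ("the graphs … must be equal"), and if `p`, `p'` are bijective then
`α(K₁) = K₁'`, `β(K₂) = K₂'` (restrictions `e₁`, `e₂`) and **`p' ∘ α|_K = β|_K ∘ p`**.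
[cite: IribarLopez2024NoetherLefschetzCycles, §2.2 Def. 4 (p. 8) and Lemma 10 (p. 7)] [cite: Auffarth2016NonSimplePPAV, §3 Thm. 3.5 and proof (pp. 9–10)] [cite: Lange2023AbelianVarietiesComplex, §1.1.2 Prop. 1.1.6 (pp. 19–20) and §3.1.2 Prop. 3.1.4 (p. 160)] -/
theorem exists_isPolarizedIso_factors_of_isPolarizedIso_quotientBy_graphSubgroup
    (hp : Injective p) (hp' : Injective p') :
    ∃ (α : ComplexTorus Φ₁ ≃+ ComplexTorus Φ₁') (β : ComplexTorus Φ₂ ≃+ ComplexTorus Φ₂')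
      (h : ComplexTorus (prodPeriod Φ₁ Φ₂) ≃+ ComplexTorus (prodPeriod Φ₁' Φ₂')),
      IsPolarizedIso Φ₁ ω₁ Φ₁' ω₁' α ∧ IsPolarizedIso Φ₂ ω₂ Φ₂' ω₂' β ∧
      IsPolarizedIso (prodPeriod Φ₁ Φ₂) (prodForm ω₁ ω₂) (prodPeriod Φ₁' Φ₂') (prodForm ω₁' ω₂') h ∧
      (∀ t, prodHomeomorph Φ₁' Φ₂' (h t) = (α (prodHomeomorph Φ₁ Φ₂ t).1, β (prodHomeomorph Φ₁ Φ₂ t).2)) ∧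
      (∀ t, k (mapMatrix (prodPeriod Φ₁ Φ₂) (quotientByPeriod (prodPeriod Φ₁ Φ₂) (graphSubgroup K₁ K₂ p))
          (quotientMatrix (prodPeriod Φ₁ Φ₂) (graphSubgroup K₁ K₂ p)) t) =
        mapMatrix (prodPeriod Φ₁' Φ₂') (quotientByPeriod (prodPeriod Φ₁' Φ₂') (graphSubgroup K₁' K₂' p'))
          (quotientMatrix (prodPeriod Φ₁' Φ₂') (graphSubgroup K₁' K₂' p')) (h t)) ∧
      (∀ t, h t ∈ graphSubgroup K₁' K₂' p' ↔ t ∈ graphSubgroup K₁ K₂ p) ∧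
      (Bijective p → Bijective p' →
        ∃ (e₁ : K₁ ≃+ K₁') (e₂ : K₂ ≃+ K₂'), (∀ s, (e₁ s : ComplexTorus Φ₁') = α s) ∧
          (∀ s, (e₂ s : ComplexTorus Φ₂') = β s) ∧ ∀ s, p' (e₁ s) = e₂ (p s)) := by
  obtain ⟨A, F₁, F₂, hA, hC, hF₁ω, hF₂ω⟩ :=
    exists_prodMap_analyticRep_of_isPolarizedIso_quotientBy_graphSubgroup hk hY hZ
  obtain ⟨B', G₁, G₂, hB', hC', -, -⟩ :=
    exists_prodMap_analyticRep_of_isPolarizedIso_quotientBy_graphSubgroup (k := k.symm) hk.symm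
      (by rw [← hY, map_map_symm_TPI]) (by rw [← hZ, map_map_symm_TPI])
  -- `G₁ = F₁⁻¹`, `G₂ = F₂⁻¹`: both `F₁ × F₂` and `(G₁ × G₂)⁻¹` represent `k`
  have hBA : B' * A = 1 := by
    apply mapMatrix_injective (Φ := quotientByPeriod (prodPeriod Φ₁ Φ₂) (graphSubgroup K₁ K₂ p))
      (Φ' := quotientByPeriod (prodPeriod Φ₁ Φ₂) (graphSubgroup K₁ K₂ p))
    funext t
    rw [← mapMatrix_mapMatrix (Φ' := quotientByPeriod (prodPeriod Φ₁' Φ₂') (graphSubgroup K₁' K₂' p')), ← hA, ← hB',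
      mapMatrix_one]
    exact k.symm_apply_apply t
  have hGF : ∀ u w, (G₁ (F₁ u), G₂ (F₂ w)) = (u, w) := fun u w ↦ by
    obtain ⟨y, hy⟩ := (quotientByPeriod (prodPeriod Φ₁ Φ₂) (graphSubgroup K₁ K₂ p)).surjective ((u, w) : E₁ × E₂)
    have h1 := hC' ((A.map (Int.cast : ℤ → ℝ)) *ᵥ y)
    rw [hC, Matrix.mulVec_mulVec, ← map_intCast_mul_TPI, hBA, Matrix.map_one Int.cast Int.cast_zero Int.cast_one,
      Matrix.one_mulVec, hy, prodMap_apply_TPI, prodMap_apply_TPI] at h1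
    simpa using h1.symm
  have hG₁ : ∀ u, G₁ (F₁ u) = u := fun u ↦ congrArg Prod.fst (hGF u 0)
  have hG₂ : ∀ w, G₂ (F₂ w) = w := fun w ↦ congrArg Prod.snd (hGF 0 w)
  -- `F₁(Λ_Y) ⊆ Λ_{Y'}` (§3: `(F₁ λ, 0) = C(λ, 0)` is a lattice vector of `X'` in `E₁' × 0`), and the same for `F₂`,
  -- `G₁ = F₁⁻¹`, `G₂ = F₂⁻¹`
  have hF₁Λ : ∀ n₁ : ι₁ → ℤ, ∃ m₁ : ι₁' → ℤ, F₁ (latticeVec Φ₁ n₁) = latticeVec Φ₁' m₁ := by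
    intro n₁
    refine exists_latticeVec_of_inl_mem_lattice Φ₁' Φ₂' p' hp'
      (n' := A *ᵥ (quotientMatrix (prodPeriod Φ₁ Φ₂) (graphSubgroup K₁ K₂ p) *ᵥ Sum.elim n₁ 0)) ?_
    rw [← map_mulVec_intVec_TPI, ← map_mulVec_intVec_TPI, hC, quotientPeriod_mulVec, prodMap_apply_TPI]
    simp [prodPeriod_apply, latticeVec, intVec]
    rfl
  have hF₂Λ : ∀ n₂ : ι₂ → ℤ, ∃ m₂ : ι₂' → ℤ, F₂ (latticeVec Φ₂ n₂) = latticeVec Φ₂' m₂ := by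
    intro n₂
    refine exists_latticeVec_of_inr_mem_lattice Φ₁' Φ₂' p'
      (n' := A *ᵥ (quotientMatrix (prodPeriod Φ₁ Φ₂) (graphSubgroup K₁ K₂ p) *ᵥ Sum.elim 0 n₂)) ?_
    rw [← map_mulVec_intVec_TPI, ← map_mulVec_intVec_TPI, hC, quotientPeriod_mulVec, prodMap_apply_TPI]
    simp [prodPeriod_apply, latticeVec, intVec]
    rfl
  have hG₁Λ : ∀ n₁ : ι₁' → ℤ, ∃ m₁ : ι₁ → ℤ, G₁ (latticeVec Φ₁' n₁) = latticeVec Φ₁ m₁ := by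
    intro n₁
    refine exists_latticeVec_of_inl_mem_lattice Φ₁ Φ₂ p hp
      (n' := B' *ᵥ (quotientMatrix (prodPeriod Φ₁' Φ₂') (graphSubgroup K₁' K₂' p') *ᵥ Sum.elim n₁ 0)) ?_
    rw [← map_mulVec_intVec_TPI, ← map_mulVec_intVec_TPI, hC', quotientPeriod_mulVec, prodMap_apply_TPI]
    simp [prodPeriod_apply, latticeVec, intVec]
    rfl
  have hG₂Λ : ∀ n₂ : ι₂' → ℤ, ∃ m₂ : ι₂ → ℤ, G₂ (latticeVec Φ₂' n₂) = latticeVec Φ₂ m₂ := by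
    intro n₂
    refine exists_latticeVec_of_inr_mem_lattice Φ₁ Φ₂ p
      (n' := B' *ᵥ (quotientMatrix (prodPeriod Φ₁' Φ₂') (graphSubgroup K₁' K₂' p') *ᵥ Sum.elim 0 n₂)) ?_
    rw [← map_mulVec_intVec_TPI, ← map_mulVec_intVec_TPI, hC', quotientPeriod_mulVec, prodMap_apply_TPI]
    simp [prodPeriod_apply, latticeVec, intVec]
    rfl
  -- the rational representations `A₁`, `B₁`, `A₂`, `B₂` of `F₁`, `G₁`, `F₂`, `G₂`
  obtain ⟨A₁, hA₁⟩ := exists_matrix_of_lattice_le (Φ := Φ₁) (Φ' := Φ₁') (L := (F₁ : E₁ →L[ℂ] E₁')) hF₁Λ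
  obtain ⟨B₁, hB₁⟩ := exists_matrix_of_lattice_le (Φ := Φ₁') (Φ' := Φ₁) (L := (G₁ : E₁' →L[ℂ] E₁)) hG₁Λ
  obtain ⟨A₂, hA₂⟩ := exists_matrix_of_lattice_le (Φ := Φ₂) (Φ' := Φ₂') (L := (F₂ : E₂ →L[ℂ] E₂')) hF₂Λ
  obtain ⟨B₂, hB₂⟩ := exists_matrix_of_lattice_le (Φ := Φ₂') (Φ' := Φ₂) (L := (G₂ : E₂' →L[ℂ] E₂)) hG₂Λ
  have hA₁' : ∀ x, Φ₁' ((A₁.map (Int.cast : ℤ → ℝ)) *ᵥ x) = F₁ (Φ₁ x) := fun x ↦ by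
    rw [hA₁, ContinuousLinearEquiv.coe_coe]
  have hA₂' : ∀ x, Φ₂' ((A₂.map (Int.cast : ℤ → ℝ)) *ᵥ x) = F₂ (Φ₂ x) := fun x ↦ by
    rw [hA₂, ContinuousLinearEquiv.coe_coe]
  have hF₁G : ∀ u', F₁ (G₁ u') = u' := fun u' ↦ by
    have h := hG₁ (F₁.symm u')  -- `G₁ = F₁⁻¹` on the nose: `G₁ (F₁ x) = x` with `x = F₁⁻¹ u'`
    rw [F₁.apply_symm_apply] at h
    rw [h, F₁.apply_symm_apply]
  have hF₂G : ∀ w', F₂ (G₂ w') = w' := fun w' ↦ by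
    have h := hG₂ (F₂.symm w')
    rw [F₂.apply_symm_apply] at h
    rw [h, F₂.apply_symm_apply]
  have hBA₁ : B₁ * A₁ = 1 := by
    apply mapMatrix_injective (Φ := Φ₁) (Φ' := Φ₁)
    funext t
    obtain ⟨x, rfl⟩ : ∃ x, proj Φ₁ x = t := ⟨lift Φ₁ t, proj_lift Φ₁ t⟩
    rw [mapMatrix_one, mapMatrix_proj, map_intCast_mul_TPI, ← Matrix.mulVec_mulVec]
    congr 1
    apply Φ₁.injective
    rw [hB₁, ContinuousLinearEquiv.coe_coe, hA₁, ContinuousLinearEquiv.coe_coe, hG₁]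
  have hAB₁ : A₁ * B₁ = 1 := by
    apply mapMatrix_injective (Φ := Φ₁') (Φ' := Φ₁')
    funext t
    obtain ⟨x, rfl⟩ : ∃ x, proj Φ₁' x = t := ⟨lift Φ₁' t, proj_lift Φ₁' t⟩
    rw [mapMatrix_one, mapMatrix_proj, map_intCast_mul_TPI, ← Matrix.mulVec_mulVec]
    congr 1
    apply Φ₁'.injective
    rw [hA₁, ContinuousLinearEquiv.coe_coe, hB₁, ContinuousLinearEquiv.coe_coe, hF₁G]
  have hBA₂ : B₂ * A₂ = 1 := by
    apply mapMatrix_injective (Φ := Φ₂) (Φ' := Φ₂)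
    funext t
    obtain ⟨x, rfl⟩ : ∃ x, proj Φ₂ x = t := ⟨lift Φ₂ t, proj_lift Φ₂ t⟩
    rw [mapMatrix_one, mapMatrix_proj, map_intCast_mul_TPI, ← Matrix.mulVec_mulVec]
    congr 1
    apply Φ₂.injective
    rw [hB₂, ContinuousLinearEquiv.coe_coe, hA₂, ContinuousLinearEquiv.coe_coe, hG₂]
  have hAB₂ : A₂ * B₂ = 1 := by
    apply mapMatrix_injective (Φ := Φ₂') (Φ' := Φ₂')
    funext t
    obtain ⟨x, rfl⟩ : ∃ x, proj Φ₂' x = t := ⟨lift Φ₂' t, proj_lift Φ₂' t⟩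
    rw [mapMatrix_one, mapMatrix_proj, map_intCast_mul_TPI, ← Matrix.mulVec_mulVec]
    congr 1
    apply Φ₂'.injective
    rw [hA₂, ContinuousLinearEquiv.coe_coe, hB₂, ContinuousLinearEquiv.coe_coe, hF₂G]
  -- the isomorphisms of polarised tori `α = ρ(A₁)`, `β = ρ(A₂)`, `h = ρ(A₁ ⊕ A₂)` (analytic representation `C`)
  obtain ⟨α, hα, hαA, -⟩ := exists_isPolarizedIso_of_matrix hBA₁ hAB₁ (F₁ : E₁ →L[ℂ] E₁') hA₁ hF₁ω
  obtain ⟨β, hβ, hβA, -⟩ := exists_isPolarizedIso_of_matrix hBA₂ hAB₂ (F₂ : E₂ →L[ℂ] E₂') hA₂ hF₂ω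
  obtain ⟨A₁', A₂', h, hh₁, hh₂, hh, hhA⟩ := hα.prod hβ
  have hc : ∀ t, prodHomeomorph Φ₁' Φ₂' (h t) = (α (prodHomeomorph Φ₁ Φ₂ t).1, β (prodHomeomorph Φ₁ Φ₂ t).2) :=
    fun t ↦ by rw [hhA, prodHomeomorph_mapMatrix_fromBlocks, ← hh₁, ← hh₂]
  -- `k ∘ π = π' ∘ h`: compare the covering vectors `A Q x` and `Q' (A₁ ⊕ A₂) x` through `Ψ'`
  have hkπ : ∀ t, k (mapMatrix (prodPeriod Φ₁ Φ₂) (quotientByPeriod (prodPeriod Φ₁ Φ₂) (graphSubgroup K₁ K₂ p))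
      (quotientMatrix (prodPeriod Φ₁ Φ₂) (graphSubgroup K₁ K₂ p)) t) =
      mapMatrix (prodPeriod Φ₁' Φ₂') (quotientByPeriod (prodPeriod Φ₁' Φ₂') (graphSubgroup K₁' K₂' p'))
        (quotientMatrix (prodPeriod Φ₁' Φ₂') (graphSubgroup K₁' K₂' p')) (h t) := by
    intro t
    obtain ⟨x, rfl⟩ : ∃ x, proj (prodPeriod Φ₁ Φ₂) x = t := ⟨lift _ t, proj_lift _ t⟩
    have hht : h (proj (prodPeriod Φ₁ Φ₂) x) = proj (prodPeriod Φ₁' Φ₂')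
        (Sum.elim ((A₁.map (Int.cast : ℤ → ℝ)) *ᵥ fun i ↦ x (Sum.inl i))
          ((A₂.map (Int.cast : ℤ → ℝ)) *ᵥ fun j ↦ x (Sum.inr j))) := by
      apply (prodHomeomorph Φ₁' Φ₂').injective
      rw [hc, prodHomeomorph_proj, prodHomeomorph_proj, hαA, hβA, mapMatrix_proj, mapMatrix_proj]
      rfl
    rw [hht, hA, mapMatrix_proj, mapMatrix_proj, mapMatrix_proj]
    congr 1
    apply (quotientByPeriod (prodPeriod Φ₁' Φ₂') (graphSubgroup K₁' K₂' p')).injective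
    rw [hC, quotientPeriod_mulVec, quotientPeriod_mulVec, prodPeriod_apply, prodPeriod_apply,
      prodMap_apply_TPI, ContinuousLinearEquiv.coe_coe, ContinuousLinearEquiv.coe_coe]
    refine Prod.ext ?_ ?_
    · change F₁ (Φ₁ fun i ↦ x (Sum.inl i)) = Φ₁' fun i ↦ ((A₁.map (Int.cast : ℤ → ℝ)) *ᵥ fun i ↦ x (Sum.inl i)) i
      rw [← hA₁']
    · change F₂ (Φ₂ fun j ↦ x (Sum.inr j)) = Φ₂' fun j ↦ ((A₂.map (Int.cast : ℤ → ℝ)) *ᵥ fun j ↦ x (Sum.inr j)) j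
      rw [← hA₂']
  have hgraph : ∀ t, h t ∈ graphSubgroup K₁' K₂' p' ↔ t ∈ graphSubgroup K₁ K₂ p := fun t ↦ by
    rw [← ker_mapMatrixHom_quotientBy (prodPeriod Φ₁' Φ₂') (graphSubgroup K₁' K₂' p'),
      ← ker_mapMatrixHom_quotientBy (prodPeriod Φ₁ Φ₂) (graphSubgroup K₁ K₂ p), AddMonoidHom.mem_ker,
      AddMonoidHom.mem_ker, mapMatrixHom_apply, mapMatrixHom_apply, ← hkπ, k.map_eq_zero_iff]
  refine ⟨α, β, h, hα, hβ, hh, hc, hkπ, hgraph, fun hpb hpb' ↦ ?_⟩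
  -- for bijective `p`, `p'`: `α(K₁) = K₁'`, `β(K₂) = K₂'` and `p' ∘ α|_K = β|_K ∘ p`
  have hc' : ∀ t', prodHomeomorph Φ₁ Φ₂ (h.symm t') =
      (α.symm (prodHomeomorph Φ₁' Φ₂' t').1, β.symm (prodHomeomorph Φ₁' Φ₂' t').2) := fun t' ↦ by
    have h1 := hc (h.symm t')
    rw [h.apply_symm_apply] at h1
    rw [h1]
    simp
  -- for `s ∈ K₁`: `(α × β)(s, p s) = (α s, β (p s)) ∈ graph(p')`
  have hgr : ∀ s : K₁, ∃ hs' : α s ∈ K₁', β (p s) = (p' ⟨α s, hs'⟩ : ComplexTorus Φ₂') := by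
    intro s
    have hm := (hgraph (graphInclusion K₁ K₂ p s)).2 (graphInclusion_mem_graphSubgroup K₁ K₂ p s)
    obtain ⟨hs', h2⟩ := (mem_graphSubgroup_iff_exists K₁' K₂' p').1 hm
    have e := hc (graphInclusion K₁ K₂ p s)
    rw [prodHomeomorph_graphInclusion] at e
    have e1 : (prodHomeomorph Φ₁' Φ₂' (h (graphInclusion K₁ K₂ p s))).1 = α s := by rw [e]
    have e2 : (prodHomeomorph Φ₁' Φ₂' (h (graphInclusion K₁ K₂ p s))).2 = β (p s) := by rw [e]
    refine ⟨e1 ▸ hs', ?_⟩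
    have e3 : (⟨(prodHomeomorph Φ₁' Φ₂' (h (graphInclusion K₁ K₂ p s))).1, hs'⟩ : K₁') = ⟨α s, e1 ▸ hs'⟩ :=
      Subtype.ext e1
    rw [← e2, h2, e3]
  have hK₁ : ∀ s : ComplexTorus Φ₁, α s ∈ K₁' ↔ s ∈ K₁ := by
    intro s
    constructor
    · intro hs'
      have hm : graphInclusion K₁' K₂' p' ⟨α s, hs'⟩ ∈ graphSubgroup K₁' K₂' p' :=
        graphInclusion_mem_graphSubgroup K₁' K₂' p' _
      have hm2 := (hgraph (h.symm (graphInclusion K₁' K₂' p' ⟨α s, hs'⟩))).1 (by rwa [h.apply_symm_apply])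
      have h3 := fst_mem_of_mem_graphSubgroup K₁ K₂ p hm2
      rw [hc', prodHomeomorph_graphInclusion] at h3
      simpa using h3
    · intro hs
      obtain ⟨hs', -⟩ := hgr ⟨s, hs⟩
      exact hs'
  have hK₂ : ∀ w : ComplexTorus Φ₂, β w ∈ K₂' ↔ w ∈ K₂ := by
    intro w
    constructor
    · intro hw'
      obtain ⟨s', hs'⟩ := hpb'.2 ⟨β w, hw'⟩
      have hm : graphInclusion K₁' K₂' p' s' ∈ graphSubgroup K₁' K₂' p' := graphInclusion_mem_graphSubgroup K₁' K₂' p' _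
      have hm2 := (hgraph (h.symm (graphInclusion K₁' K₂' p' s'))).1 (by rwa [h.apply_symm_apply])
      have h3 := snd_mem_of_mem_graphSubgroup K₁ K₂ p hm2
      rw [hc', prodHomeomorph_graphInclusion, hs'] at h3
      simpa using h3
    · intro hw
      obtain ⟨s, hs⟩ := hpb.2 ⟨w, hw⟩
      obtain ⟨hs', h2⟩ := hgr s
      have h4 : ((p s : K₂) : ComplexTorus Φ₂) = w := by rw [hs]
      rw [← h4, h2]
      exact SetLike.coe_mem _
  let e₁ : K₁ ≃+ K₁' :=
    { toFun := fun s ↦ ⟨α s, (hK₁ _).2 s.2⟩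
      invFun := fun s' ↦ ⟨α.symm s', (hK₁ _).1 (by rw [α.apply_symm_apply]; exact s'.2)⟩
      left_inv := fun s ↦ Subtype.ext (α.symm_apply_apply _)
      right_inv := fun s' ↦ Subtype.ext (α.apply_symm_apply _)
      map_add' := fun s t ↦ Subtype.ext (by simp) }
  let e₂ : K₂ ≃+ K₂' :=
    { toFun := fun w ↦ ⟨β w, (hK₂ _).2 w.2⟩
      invFun := fun w' ↦ ⟨β.symm w', (hK₂ _).1 (by rw [β.apply_symm_apply]; exact w'.2)⟩
      left_inv := fun w ↦ Subtype.ext (β.symm_apply_apply _)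
      right_inv := fun w' ↦ Subtype.ext (β.apply_symm_apply _)
      map_add' := fun w t ↦ Subtype.ext (by simp) }
  refine ⟨e₁, e₂, fun s ↦ rfl, fun w ↦ rfl, fun s ↦ ?_⟩
  obtain ⟨hs', h2⟩ := hgr s
  apply Subtype.ext
  change ((p' ⟨α s, _⟩ : K₂') : ComplexTorus Φ₂') = β (p s)
  exact h2.symm

end Main

/-! ### §6 The iff: isomorphic triples ⟺ isomorphic data -/

section Iff

variable {ι₁ ι₂ ι₁' ι₂' : Type*} [Fintype ι₁] [Fintype ι₂] [Fintype ι₁'] [Fintype ι₂']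
  [DecidableEq ι₁] [DecidableEq ι₂] [DecidableEq ι₁'] [DecidableEq ι₂']
  {E₁ E₂ E₁' E₂' : Type*} [NormedAddCommGroup E₁] [NormedSpace ℂ E₁] [NormedAddCommGroup E₂] [NormedSpace ℂ E₂]
  [NormedAddCommGroup E₁'] [NormedSpace ℂ E₁'] [NormedAddCommGroup E₂'] [NormedSpace ℂ E₂']
  {Φ₁ : (ι₁ → ℝ) ≃L[ℝ] E₁} {Φ₂ : (ι₂ → ℝ) ≃L[ℝ] E₂} {Φ₁' : (ι₁' → ℝ) ≃L[ℝ] E₁'} {Φ₂' : (ι₂' → ℝ) ≃L[ℝ] E₂'}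
  {ω₁ : E₁ [⋀^Fin 2]→L[ℝ] ℝ} {ω₂ : E₂ [⋀^Fin 2]→L[ℝ] ℝ} {ω₁' : E₁' [⋀^Fin 2]→L[ℝ] ℝ} {ω₂' : E₂' [⋀^Fin 2]→L[ℝ] ℝ}
  {K₁ : AddSubgroup (ComplexTorus Φ₁)} {K₂ : AddSubgroup (ComplexTorus Φ₂)}
  {K₁' : AddSubgroup (ComplexTorus Φ₁')} {K₂' : AddSubgroup (ComplexTorus Φ₂')}
  {p : K₁ →+ K₂} {p' : K₁' →+ K₂'} [Finite (graphSubgroup K₁ K₂ p)] [Finite (graphSubgroup K₁' K₂' p')]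

/-- **Row A4-77, assembled: isomorphic triples ⟺ isomorphic data.**  For bijections `p : K₁ ≅ K₂`, `p' : K₁' ≅ K₂'`
between finite subgroups of polarised tori `(Y, ω₁)`, `(Z, ω₂)`, `(Y', ω₁')`, `(Z', ω₂')`, the following are
equivalent: (1) there are isomorphisms of polarised tori `α : (Y, ω₁) ⥲ (Y', ω₁')`, `β : (Z, ω₂) ⥲ (Z', ω₂')` with
`α(K₁) = K₁'`, `β(K₂) = K₂'` and `p' ∘ α|_K = β|_K ∘ p`; (2) there is an isomorphism of polarised tori
`((Y × Z)/graph(p), ω₁ ⊞ ω₂) ⥲ ((Y' × Z')/graph(p'), ω₁' ⊞ ω₂')` carrying the images of `Y × 0`, `0 × Z` onto those of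
`Y' × 0`, `0 × Z'`.  With `K₁ = K(θ_Y)`, `K₂ = K(θ_Z)`, antisymplectic `p` and A4-76 this is "`𝒜'_{u,g−u,δ}` parametrizes
triplets `(X, Y, Z, θ)`" / the fibre description of Thm. 3.5; for `(Y', Z') = (Y, Z)`: the isomorphism class of
the TRIPLE `((Y × Z)/graph(p) ⊃ Y, Z)` is exactly the double coset `Aut(Z, θ_Z)|_K · p · Aut(Y, θ_Y)|_K`.
[cite: IribarLopez2024NoetherLefschetzCycles, §2.2 Lemma 10 (p. 7) and Def. 4 (p. 8)] [cite: Auffarth2016NonSimplePPAV, §3 Thm. 3.5 (pp. 9–10)] -/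
theorem exists_isPolarizedIso_quotientBy_graphSubgroup_iff (hp : Bijective p) (hp' : Bijective p') :
    (∃ (α : ComplexTorus Φ₁ ≃+ ComplexTorus Φ₁') (β : ComplexTorus Φ₂ ≃+ ComplexTorus Φ₂') (e₁ : K₁ ≃+ K₁')
        (e₂ : K₂ ≃+ K₂'), IsPolarizedIso Φ₁ ω₁ Φ₁' ω₁' α ∧ IsPolarizedIso Φ₂ ω₂ Φ₂' ω₂' β ∧
        (∀ s, (e₁ s : ComplexTorus Φ₁') = α s) ∧ (∀ s, (e₂ s : ComplexTorus Φ₂') = β s) ∧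
        ∀ s, p' (e₁ s) = e₂ (p s)) ↔
    ∃ k : ComplexTorus (quotientByPeriod (prodPeriod Φ₁ Φ₂) (graphSubgroup K₁ K₂ p)) ≃+
        ComplexTorus (quotientByPeriod (prodPeriod Φ₁' Φ₂') (graphSubgroup K₁' K₂' p')),
      IsPolarizedIso (quotientByPeriod (prodPeriod Φ₁ Φ₂) (graphSubgroup K₁ K₂ p)) (prodForm ω₁ ω₂)
        (quotientByPeriod (prodPeriod Φ₁' Φ₂') (graphSubgroup K₁' K₂' p')) (prodForm ω₁' ω₂') k ∧
      ((subtorus (prodPeriod Φ₁ Φ₂) (fstSubspace : Submodule ℝ (ι₁ ⊕ ι₂ → ℝ))).map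
          (mapMatrixHom (prodPeriod Φ₁ Φ₂) (quotientByPeriod (prodPeriod Φ₁ Φ₂) (graphSubgroup K₁ K₂ p))
            (quotientMatrix (prodPeriod Φ₁ Φ₂) (graphSubgroup K₁ K₂ p)))).map k.toAddMonoidHom =
        (subtorus (prodPeriod Φ₁' Φ₂') (fstSubspace : Submodule ℝ (ι₁' ⊕ ι₂' → ℝ))).map
          (mapMatrixHom (prodPeriod Φ₁' Φ₂') (quotientByPeriod (prodPeriod Φ₁' Φ₂') (graphSubgroup K₁' K₂' p'))
            (quotientMatrix (prodPeriod Φ₁' Φ₂') (graphSubgroup K₁' K₂' p'))) ∧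
      ((subtorus (prodPeriod Φ₁ Φ₂) (sndSubspace : Submodule ℝ (ι₁ ⊕ ι₂ → ℝ))).map
          (mapMatrixHom (prodPeriod Φ₁ Φ₂) (quotientByPeriod (prodPeriod Φ₁ Φ₂) (graphSubgroup K₁ K₂ p))
            (quotientMatrix (prodPeriod Φ₁ Φ₂) (graphSubgroup K₁ K₂ p)))).map k.toAddMonoidHom =
        (subtorus (prodPeriod Φ₁' Φ₂') (sndSubspace : Submodule ℝ (ι₁' ⊕ ι₂' → ℝ))).map
          (mapMatrixHom (prodPeriod Φ₁' Φ₂') (quotientByPeriod (prodPeriod Φ₁' Φ₂') (graphSubgroup K₁' K₂' p'))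
            (quotientMatrix (prodPeriod Φ₁' Φ₂') (graphSubgroup K₁' K₂' p'))) := by
  constructor
  · rintro ⟨α, β, e₁, e₂, hα, hβ, he₁, he₂, hrel⟩
    -- `p' = e₂ ∘ p ∘ e₁⁻¹`; then FILE H
    have hp'eq : p' = e₂.toAddMonoidHom.comp (p.comp e₁.symm.toAddMonoidHom) := by
      ext s'
      simp only [AddMonoidHom.coe_comp, AddEquiv.coe_toAddMonoidHom, Function.comp_apply]
      rw [← hrel, e₁.apply_symm_apply]
    subst hp'eq
    obtain ⟨h, k, -, -, hk, -, hY, hZ⟩ :=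
      exists_isPolarizedIso_quotientBy_graphSubgroup_conj_map_subtorus hα hβ he₁ he₂ p
    exact ⟨k, hk, hY, hZ⟩
  · rintro ⟨k, hk, hY, hZ⟩
    obtain ⟨α, β, h, hα, hβ, -, -, -, -, hrest⟩ :=
      exists_isPolarizedIso_factors_of_isPolarizedIso_quotientBy_graphSubgroup hk hY hZ hp.1 hp'.1
    obtain ⟨e₁, e₂, he₁, he₂, hrel⟩ := hrest hp hp'
    exact ⟨α, β, e₁, e₂, hα, hβ, he₁, he₂, hrel⟩

end Iff

end ComplexTorus

end Literature.Geometry.Kaehler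

end
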